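import Summits.ValiantsHypothesis.ValiantsHypothesis.Theses.ChowBorderDepth3
import Summits.ValiantsHypothesis.ValiantsHypothesis.Theses.SummationBits
import Literature.Computability.AlgebraicComplexity.DetInVP
import Literature.Computability.AlgebraicComplexity.StandardFamiliesProofs

/-!
# Strategist r1 (second opinion) — typed companion to `STRATEGY-CENSUS-r1.md`

Crux item `stmt-ValiantsHypothesis-5934`, decl
`Summit.ValiantsHypothesis.ValiantsHypothesis.Theses.ChowBorderDepth3.Depth3Thesis`
(shared verbatim with `…Theses.SummationBits.Depth3Thesis`).

Kernel-checked content (no `sorry`):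

* `depth3Thesis_shared` — the two route decls are the same proposition (`Iff.rfl`).
* `valiantsHypothesis_of_depth3Thesis` — SUMMIT-STRENGTH CERTIFICATE: the crux ALONE implies the
  summit `ValiantsHypothesis` (`VP ℂ ≠ VNP ℂ`), because the chasm `Depth3Chasm` (item 5935) and the
  assembly (item 5941) are proved in the tree.  This is the theorem the redirect instruction (3) asks
  for; it does not depend on any skeleton or stub.
* `Depth3LowerBound f` — the crux SHAPE for an arbitrary family `f n ∈ ℂ[x_{ij} : i,j < n]`;
  `depth3Thesis_iff` : the crux is `Depth3LowerBound per`.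
* `not_depth3LowerBound_of_isVPFamily` — `_false_without_per`: the crux shape FAILS for every VP
  family of total degree `≤ n` (proved chasm); in particular
  `not_depth3LowerBound_det` — the determinant analogue of the crux is FALSE.  Hence any proof of the
  crux must use a property of `per_n` not shared by `det_n` inside the degree window of the live
  line (every coefficient-support / flattening / real-norm measure is excluded: see the census).
* `depth3LowerBound_not_isVPFamily` — conversely the crux shape for a degree-`≤ n` family says
  exactly "`f ∉ VP`" PLUS the depth-3 quantitative content: `Depth3LowerBound f → ¬ IsVPFamily f`.

Typed (open) statements from the r1 inventory, referenced by the census: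

* `SeparableBasisBound` — the SEPARABLE-CONFIGURATION piece of the crux (all linear parts drawn from
  one linearly independent family `y`; univariate polynomials `g i t` in them): lower bound on the
  number of summands alone, degree-free.  Equivalent to a lower bound for `per_n` against
  `GL_{n²}`-orbits of commutative (diagonal) ROABPs; OPEN in general bases, known in the standard
  basis (`StandardBasisBound`, Nisan bipartition rank `binom(n,⌊n/2⌋)`, not landed here).
* `RectangularStrengthening` — the r1 STRENGTHEN candidate `S⁺` (rectangular permanents,
  uniform in the number of rows), typed and rejected in the census (no inductive engine).
* `StandardBasisBound` — the standard-basis rung (provable by the coefficient-matrix rank w.r.t. the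
  top/bottom row split; each separable summand has rank ≤ 1).

Nothing here is a new route item; the file elaborates with the tree and is published as a crux
workfile (`Cruxes/Depth3Thesis/StrategyCensusR1.lean`).
-/

set_option linter.dupNamespace false

namespace Summit.ValiantsHypothesis.ValiantsHypothesis.Cruxes.Depth3Thesis.StrategistR1

open Literature.Computability.AlgebraicComplexity

/-- The two route decls (`ChowBorderDepth3.Depth3Thesis`, `SummationBits.Depth3Thesis`) agree. -/
theorem depth3Thesis_shared :
    Summit.ValiantsHypothesis.ValiantsHypothesis.Theses.ChowBorderDepth3.Depth3Thesis ↔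
      Summit.ValiantsHypothesis.ValiantsHypothesis.Theses.SummationBits.Depth3Thesis :=
  Iff.rfl

/-- SUMMIT-STRENGTH CERTIFICATE.  The crux alone implies the summit: `Depth3Thesis → VP ℂ ≠ VNP ℂ`,
via the PROVED chasm (`Depth3Chasm_holds`, item 5935) and the PROVED assembly (`Assembly_holds`,
item 5941), the degree fact `totalDegree_perPoly_holds`, the bundling lemma
`mem_VP_ofFintype_iff_holds` and `perFamily_mem_VNP_holds`. -/
theorem valiantsHypothesis_of_depth3Thesis
    (h : Summit.ValiantsHypothesis.ValiantsHypothesis.Theses.ChowBorderDepth3.Depth3Thesis) :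
    ValiantsHypothesis :=
  Summit.ValiantsHypothesis.ValiantsHypothesis.Theses.SummationBits.Assembly_holds
    Summit.ValiantsHypothesis.ValiantsHypothesis.Theses.SummationBits.Depth3Chasm_holds
    h
    (fun n => by
      rw [Literature.Computability.AlgebraicComplexity.totalDegree_perPoly_holds (n := Fin n) (k := ℂ),
        Fintype.card_fin])
    (Literature.Computability.AlgebraicComplexity.mem_VP_ofFintype_iff_holds _)
    (Literature.Computability.AlgebraicComplexity.perFamily_mem_VNP_holds ℂ)

/-- The crux SHAPE for an arbitrary family `f n ∈ ℂ[x_{ij}]`, `i j : Fin n`. -/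
def Depth3LowerBound (f : ∀ n : ℕ, MvPolynomial (Fin n × Fin n) ℂ) : Prop :=
  ∀ c : ℕ, ∃ n : ℕ, ∀ P : ArithCircuit ℂ (Fin n × Fin n),
    P.Computes (f n) → P.productDepth ≤ 1 → (n + 2) ^ (c * Nat.sqrt n + c) < P.edgeSize

/-- The crux is the crux shape at `per`. -/
theorem depth3Thesis_iff :
    Summit.ValiantsHypothesis.ValiantsHypothesis.Theses.ChowBorderDepth3.Depth3Thesis ↔
      Depth3LowerBound (fun n => perPoly (Fin n) ℂ) :=
  Iff.rfl

/-- `_false_without_per` (tightness of the crux shape): for every VP family of total degree `≤ n`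
the crux shape is FALSE — the proved chasm supplies, for some `c` and every `n`, a product-depth-`≤ 1`
circuit with at most `(n+2)^(c⌊√deg⌋+c) ≤ (n+2)^(c⌊√n⌋+c)` wires. -/
theorem not_depth3LowerBound_of_isVPFamily (f : ∀ n : ℕ, MvPolynomial (Fin n × Fin n) ℂ)
    (hf : IsVPFamily f) (hdeg : ∀ n, (f n).totalDegree ≤ n) : ¬ Depth3LowerBound f := by
  intro h
  obtain ⟨c, hc⟩ :=
    Summit.ValiantsHypothesis.ValiantsHypothesis.Theses.SummationBits.Depth3Chasm_holds
      (σ := fun n => Fin n × Fin n) f hf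
  obtain ⟨n, hn⟩ := h c
  obtain ⟨P, hP, hd, hE⟩ := hc n
  have h1 : (n + 2) ^ (c * Nat.sqrt n + c) < P.edgeSize := hn P hP hd
  have h2 : (n + 2) ^ (c * Nat.sqrt ((f n).totalDegree) + c) ≤ (n + 2) ^ (c * Nat.sqrt n + c) :=
    Nat.pow_le_pow_right (Nat.succ_pos _)
      (Nat.add_le_add_right (Nat.mul_le_mul (le_refl c) (Nat.sqrt_le_sqrt (hdeg n))) c)
  exact lt_irrefl _ (h1.trans_le (hE.trans h2))

/-- The DETERMINANT analogue of the crux is false (`det ∈ VP`, `deg det_n = n`, chasm). -/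
theorem not_depth3LowerBound_det : ¬ Depth3LowerBound (fun n => detPoly (Fin n) ℂ) :=
  not_depth3LowerBound_of_isVPFamily _ (isVPFamily_detPoly_holds ℂ)
    (fun n => by
      show (detPoly (Fin n) ℂ).totalDegree ≤ n
      rw [Literature.Computability.AlgebraicComplexity.totalDegree_detPoly_holds (n := Fin n) (k := ℂ),
        Fintype.card_fin])

/-- Conversely, for a degree-`≤ n` family the crux shape contains "`f ∉ VP`". -/
theorem depth3LowerBound_not_isVPFamily (f : ∀ n : ℕ, MvPolynomial (Fin n × Fin n) ℂ)
    (hdeg : ∀ n, (f n).totalDegree ≤ n) (h : Depth3LowerBound f) : ¬ IsVPFamily f :=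
  fun hf => not_depth3LowerBound_of_isVPFamily f hf hdeg h

/-- In particular the crux says (at least) `per ∉ VP` — the summit modulo `per ∈ VNP`. -/
theorem depth3Thesis_not_isVPFamily_per
    (h : Summit.ValiantsHypothesis.ValiantsHypothesis.Theses.ChowBorderDepth3.Depth3Thesis) :
    ¬ IsVPFamily (fun n => perPoly (Fin n) ℂ) :=
  depth3LowerBound_not_isVPFamily _
    (fun n => by
      rw [Literature.Computability.AlgebraicComplexity.totalDegree_perPoly_holds (n := Fin n) (k := ℂ),
        Fintype.card_fin])
    h

/-! ## Typed statements of the r1 inventory (open unless said otherwise; none is a route item) -/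

/-- DECOMPOSITION AXIS "configuration of the linear parts" — the SEPARABLE piece.  Every affine
ΣΠΣ expression groups, gate by gate, its factors by linear part: `Π_j ℓ_ij = Π_t g_it(y_t)` with
univariate `g_it`.  If the linear parts `y_t` of the whole expression are LINEARLY INDEPENDENT, each
summand is separable in the coordinates `y`, hence has coefficient-matrix rank `≤ 1` across every
bipartition of `y`, and the number of summands alone is bounded below by the best bipartition rank of
`per_n ∘ A⁻¹` — a `GL_{n²}`-ROBUST Nisan rank.  Degree-free.  OPEN for general bases (= a lower bound
for `per_n` against `GL`-orbits of commutative ROABPs of width `(n+2)^(c⌊√n⌋+c)`); it does NOT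
imply the crux (padding a cheap expression with `+ℓ' − ℓ'` leaves the separable class, so the
non-separable piece is already the whole crux).  [folklore; cf. arXiv:2102.05632 Claim 6.1 for the
sparse (monomial `g`) case, which is homogeneous depth 3 and exponential by Nisan–Wigderson Thm 0] -/
def SeparableBasisBound : Prop :=
  ∀ c : ℕ, ∃ n₀ : ℕ, ∀ n : ℕ, n₀ ≤ n →
    ∀ (r m : ℕ) (y : Fin m → MvPolynomial (Fin n × Fin n) ℂ) (g : Fin r → Fin m → Polynomial ℂ),
      (∀ t, (y t).IsHomogeneous 1) → LinearIndependent ℂ y →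
        (∑ i, ∏ t, Polynomial.aeval (y t) (g i t)) = perPoly (Fin n) ℂ →
          (n + 2) ^ (c * Nat.sqrt n + c) < r

/-- The STANDARD-BASIS rung of `SeparableBasisBound` (provable now, not landed here): a sum of `r`
products of univariate polynomials in the individual variables `x_p` that equals `per_n` has
`r ≥ binom(n, ⌊n/2⌋)`, whatever the degrees — coefficient matrix w.r.t. (rows `< ⌊n/2⌋` | the rest)
has rank `binom(n,⌊n/2⌋)` for `per_n` and `≤ 1` per separable summand (Nisan 1991 bipartition rank).
So in the standard basis the interpolation regime (`D ≫ n`) is harmless; all the power of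
high-degree depth-3 tricks over `ℂ` (Ben-Or, GKKS duality) lives in DEPENDENT or SKEW configurations.
[Nisan 1991, STOC, Thm 1 (rank bound), adapted] -/
def StandardBasisBound : Prop :=
  ∀ (n r : ℕ) (g : Fin r → (Fin n × Fin n) → Polynomial ℂ),
    (∑ i, ∏ p, Polynomial.aeval (MvPolynomial.X (R := ℂ) p) (g i p)) = perPoly (Fin n) ℂ →
      n.choose (n / 2) ≤ r


/-- STRENGTHEN S⁺ (r1): the RECTANGULAR permanent family `per_{k,n} = Σ_{f : [k] ↪ [n]} Π_i x_{i,f(i)}`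
interpolates between the trivial `k ≤ k₀` regime (where `per_{k,n}` is a width-`2^k` iterated
matrix product of length `n`, in VP, with ΣΠΣ complexity `n^{Θ̃(√k)}` by the chasm) and the crux
(`k = n`).  The uniform-in-`k` strengthening below implies the crux at `k = n` (identify
`Fin n ↪ Fin n` with `Equiv.Perm (Fin n)`), and is consistent with the chasm only because
`k₀` may depend on `c` (`k₀(c) ≈ exp(c²/C²)`).  It is recorded as the r1 candidate for an
INDUCTIVE form — and rejected: a row-derivative `∂/∂x_{1j}` maps a ΣΠΣ expression with parameters
`(r, D)` to one with `(r·D, D-1)`, so induction on `k` loses the factor `D ≤ T_c` at the first step,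
and the only degree-robust transfer (LST 2021 via `IMM_{2^{k'},d} ≤_proj per_{k,n}`) reaches
`n^{Ω(√log k)}`, not `n^{c√k}`. [folklore; LST 2021 Cor. 4] -/
noncomputable def rectPer (k n : ℕ) : MvPolynomial (Fin k × Fin n) ℂ :=
  ∑ f : Fin k ↪ Fin n, ∏ i : Fin k, MvPolynomial.X (i, f i)

/-- See `rectPer`. -/
def RectangularStrengthening : Prop :=
  ∀ c : ℕ, ∃ k₀ : ℕ, ∀ k : ℕ, k₀ ≤ k → ∀ n : ℕ, k ≤ n →
    ∀ P : ArithCircuit ℂ (Fin k × Fin n),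
      P.Computes (rectPer k n) → P.productDepth ≤ 1 → (n + 2) ^ (c * Nat.sqrt k + c) < P.edgeSize

end Summit.ValiantsHypothesis.ValiantsHypothesis.Cruxes.Depth3Thesis.StrategistR1
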